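import Literature.Combinatorics.Optimization.ShellLawPopulationMixture
import HarnessLib

/-!
# Splitting a shell sum along a `π`-stable class: the SUM form of the class decomposition

`ShellLawPopulationMixture.card_shellIn_split_class` (lit g36, the cell's (K0) step) splits the shell of a `π`-stable ground
set `S` along a `π`-stable class `C ⊆ S` at the level of COUNTS with a threaded predicate: the map `U ↦ (U ∩ C, U ∖ C)` is a
bijection from `{U ∈ Shell_S(t,c) : |U ∩ C| = t₁, |half(U) ∩ C| = c₁}` onto `Shell_C(t₁,c₁) × Shell_{S∖C}(t−t₁, c−c₁)`. This
leaf records the same bijection as an identity of SUMS of an ARBITRARY function of the cut (values in any additive commutative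
monoid), which is what TILTED masks need (the cell's small-block line conditions on the states of the internal edges of the
block — eng MEMO-23 (K0)/(T-K3) — and a tilted mask `ψ(|U∩H|)·C_u(U)²` is not a function of `|U ∩ H|` alone; eng MEMO-26 §4):

* §1 **`sum_shellIn_filter_class_eq`** — at a fixed class pattern `(t₁, c₁)`:
  `Σ_{U ∈ Shell_S(t,c), |U∩C| = t₁, |half U ∩ C| = c₁} F(U) = Σ_{A ∈ Shell_C(t₁,c₁)} Σ_{B ∈ Shell_{S∖C}(t−t₁,c−c₁)} F(A ∪ B)`;
* §2 **`sum_shellIn_split_class`** — summed over the patterns: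
  `Σ_{U ∈ Shell_S(t,c)} F(U) = Σ_{t₁ ≤ t} Σ_{c₁ ≤ c} Σ_{A ∈ Shell_C(t₁,c₁)} Σ_{B ∈ Shell_{S∖C}(t−t₁,c−c₁)} F(A ∪ B)`.

All PROVED, 0 sorry, no definitions, no named facts; the bijection is the one of `card_shellIn_split_class` (proof adapted from it).
Cell pnp-psdrank (engine seat g27). Bookkeeping on Rothvoß's slack-matrix combinatorics.

## References
* [Rothvoss2017] T. Rothvoß, *The matching polytope has exponential extension complexity*, J. ACM 64 (2017), §2 (PDF pp. 5–6).
* [GodsilMeagher2015] C. Godsil, K. Meagher, *Erdős–Ko–Rado Theorems: Algebraic Approaches*, §15.2.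
-/

noncomputable section

open Finset

namespace Literature.Combinatorics.Optimization

namespace ShellStep

variable {n : ℕ} {π : Fin n → Fin n}

section ClassSplit

variable (hπ : ∀ v, π (π v) = v)
include hπ

/-! ### §1 The sum over one class pattern -/

/-- **Sum over a fixed class pattern.** For `π`-stable `C ⊆ S`, `t₁ ≤ t`, `c₁ ≤ c` and any `F` with values in an additive commutative
monoid: `Σ_{U ∈ Shell_S(t,c), |U∩C| = t₁, |half U ∩ C| = c₁} F(U) = Σ_{A ∈ Shell_C(t₁,c₁)} Σ_{B ∈ Shell_{S∖C}(t−t₁,c−c₁)} F(A ∪ B)`.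
[cite: Rothvoss2017, §2 (PDF p. 6)] -/
theorem sum_shellIn_filter_class_eq {M : Type*} [AddCommMonoid M] {S C : Finset (Fin n)} (hC : ∀ v ∈ C, π v ∈ C)
    (hCS : C ⊆ S) {t c t₁ c₁ : ℕ} (ht : t₁ ≤ t) (hc : c₁ ≤ c) (F : Finset (Fin n) → M) :
    ∑ U ∈ (shellIn π S t c).filter (fun U => (U ∩ C).card = t₁ ∧ (half π U ∩ C).card = c₁), F U =
      ∑ A ∈ shellIn π C t₁ c₁, ∑ B ∈ shellIn π (S \ C) (t - t₁) (c - c₁), F (A ∪ B) := by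
  classical
  rw [← sum_product' (f := fun A B => F (A ∪ B))]
  refine sum_nbij' (fun U => (U ∩ C, U \ C)) (fun AB => AB.1 ∪ AB.2) ?_ ?_ ?_ ?_ ?_
  · intro U hU
    simp only [mem_filter, mem_shellIn] at hU
    obtain ⟨⟨hUS, hUt, hUc⟩, hU1, hU2⟩ := hU
    obtain ⟨h1, h2⟩ := half_inter_class hπ (U := U) hC
    have hc12 := card_sdiff_add_card_inter (half π U) C
    have ht12 := card_sdiff_add_card_inter U C
    simp only [mem_product, mem_shellIn]
    exact ⟨⟨inter_subset_right, hU1, by rw [h1, hU2]⟩, ⟨fun v hv => mem_sdiff.2 ⟨hUS (mem_sdiff.1 hv).1,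
      (mem_sdiff.1 hv).2⟩, by omega, by rw [h2]; omega⟩⟩
  · rintro ⟨A, B⟩ hAB
    simp only [mem_product, mem_shellIn] at hAB
    obtain ⟨⟨hAC, hAt, hAc⟩, ⟨hBS, hBt, hBc⟩⟩ := hAB
    have hdisj : Disjoint A B := disjoint_of_subset_left hAC (disjoint_of_subset_right hBS disjoint_sdiff)
    have hinter : (A ∪ B) ∩ C = A := by
      rw [union_inter_distrib_right, inter_eq_left.2 hAC,
        ((disjoint_of_subset_left hBS) sdiff_disjoint |> disjoint_iff_inter_eq_empty.1), union_empty]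
    have hsdiff : (A ∪ B) \ C = B := by
      rw [union_sdiff_distrib, sdiff_eq_empty_iff_subset.2 hAC, empty_union]
      exact sdiff_eq_self_of_disjoint ((disjoint_of_subset_left hBS) sdiff_disjoint)
    obtain ⟨h1, h2⟩ := half_inter_class hπ (U := A ∪ B) hC
    rw [hinter] at h1
    rw [hsdiff] at h2
    have hc12 := card_sdiff_add_card_inter (half π (A ∪ B)) C
    simp only [mem_filter, mem_shellIn]
    refine ⟨⟨union_subset (hAC.trans hCS) (hBS.trans sdiff_subset), ?_, ?_⟩, ?_, ?_⟩
    · rw [card_union_of_disjoint hdisj, hAt, hBt]; omega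
    · rw [← h1, ← h2, hAc, hBc] at hc12; omega
    · rw [hinter, hAt]
    · rw [← h1, hAc]
  · intro U _
    show U ∩ C ∪ U \ C = U
    rw [union_comm, sdiff_union_inter]
  · rintro ⟨A, B⟩ hAB
    simp only [mem_product, mem_shellIn] at hAB
    obtain ⟨⟨hAC, _, _⟩, ⟨hBS, _, _⟩⟩ := hAB
    have hinter : (A ∪ B) ∩ C = A := by
      rw [union_inter_distrib_right, inter_eq_left.2 hAC,
        ((disjoint_of_subset_left hBS) sdiff_disjoint |> disjoint_iff_inter_eq_empty.1), union_empty]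
    have hsdiff : (A ∪ B) \ C = B := by
      rw [union_sdiff_distrib, sdiff_eq_empty_iff_subset.2 hAC, empty_union]
      exact sdiff_eq_self_of_disjoint ((disjoint_of_subset_left hBS) sdiff_disjoint)
    show ((A ∪ B) ∩ C, (A ∪ B) \ C) = (A, B)
    rw [hinter, hsdiff]
  · intro U _
    show F U = F ((U ∩ C, U \ C).1 ∪ (U ∩ C, U \ C).2)
    simp only
    rw [union_comm, sdiff_union_inter]

/-! ### §2 The full class decomposition of a shell sum -/

/-- **Class decomposition of a shell sum.** For `π`-stable `C ⊆ S` and any `F` with values in an additive commutative monoid: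
`Σ_{U ∈ Shell_S(t,c)} F(U) = Σ_{t₁ ≤ t} Σ_{c₁ ≤ c} Σ_{A ∈ Shell_C(t₁,c₁)} Σ_{B ∈ Shell_{S∖C}(t−t₁,c−c₁)} F(A ∪ B)`
(the class pattern of `U` is `(|U ∩ C|, |half(U) ∩ C|)`). [cite: Rothvoss2017, §2 (PDF p. 6)] [cite: GodsilMeagher2015, §15.2] -/
theorem sum_shellIn_split_class {M : Type*} [AddCommMonoid M] {S C : Finset (Fin n)} (hC : ∀ v ∈ C, π v ∈ C)
    (hCS : C ⊆ S) (t c : ℕ) (F : Finset (Fin n) → M) :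
    ∑ U ∈ shellIn π S t c, F U =
      ∑ t₁ ∈ range (t + 1), ∑ c₁ ∈ range (c + 1),
        ∑ A ∈ shellIn π C t₁ c₁, ∑ B ∈ shellIn π (S \ C) (t - t₁) (c - c₁), F (A ∪ B) := by
  classical
  -- fibre over the class pattern `(|U ∩ C|, |half U ∩ C|) ∈ [0,t] × [0,c]`
  have hmaps : ∀ U ∈ shellIn π S t c, ((U ∩ C).card, (half π U ∩ C).card) ∈ range (t + 1) ×ˢ range (c + 1) := by
    intro U hU
    obtain ⟨_, hUt, hUc⟩ := mem_shellIn.1 hU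
    rw [mem_product, mem_range, mem_range]
    constructor
    · have := card_le_card (inter_subset_left (s₁ := U) (s₂ := C)); omega
    · have := card_le_card (inter_subset_left (s₁ := half π U) (s₂ := C)); omega
  rw [← sum_fiberwise_of_maps_to hmaps, sum_product]
  refine sum_congr rfl fun t₁ ht₁ => sum_congr rfl fun c₁ hc₁ => ?_
  rw [mem_range] at ht₁ hc₁
  have e : ((shellIn π S t c).filter fun U => ((U ∩ C).card, (half π U ∩ C).card) = (t₁, c₁)) =
      ((shellIn π S t c).filter fun U => (U ∩ C).card = t₁ ∧ (half π U ∩ C).card = c₁) :=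
    filter_congr fun U _ => by rw [Prod.mk.injEq]
  rw [e]
  exact sum_shellIn_filter_class_eq hπ hC hCS (by omega) (by omega) F

end ClassSplit

end ShellStep

end Literature.Combinatorics.Optimization

end
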